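import Mathlib
import Literature.NumberTheory.LFunctions.HarmonicSumFlatRange
import Summits.RiemannHypothesis.RiemannHypothesis.Theorems.IntegerScrewPropKK
import HarnessLib

/-!
# Route `IntegerScrew` — PROPOSITION K″ packaged: thin bottoms cost `O(log R·log log R)·D` in the window functional
# (CONTINUUM-LIMIT §27.2, kernel form for the assembly)

`IntegerScrewPropKK.propKK_explicit` bounds the window functional of `W = (Q, R] ⊂ Ω_R` against `D_{Ω_R}` with explicit
harmonic sums.  Here every sum is replaced by its elementary size (`S_W ≤ H_R ≤ 1 + log R`, `H_Q ≥ log(Q+1)`,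
`H_Q ≤ 1 + log Q`, `π_Q ≤ e⁵ log Q`, hubs up to `Y = ⌊R/Q⌋`, `log(Y+1) ≥ log R − log Q`), in the regime
`2e⁵·log Q ≤ log R − log Q` of very thin bottoms (`Q ≤ R^{1/298}`):

* **`propKK_thin_bottom`** — for `2 ≤ Q`, `2e⁵ log Q ≤ log R − log Q` and every `g`:
  `(Σ_{Q<x≤R} g x/x − (S_W/H_Q)·Σ_{b≤Q} g b/b)² ≤ 2000·e²⁰·(log R + log 4 + e⁵ log(R+1)(log log R + 4))·D_{Ω_R}(g)`.

In κ-units (CONTINUUM-LIMIT 27.1: κ ≤ (H_Q log R/H_R²)·[this constant]) this is κ(thin bottom) = O((log Q + 1)·log log R)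
— PROP. K″; together with THEOREM A (`IntegerScrewTheoremA.theoremA`, κ = O(log R/log Q) for Q ≥ 148) every bottom
`Q` of `Ω_R` is covered.  Constants crude and irrelevant.  RH-free, elementary.
Nothing in this file bears on the truth of RH.
References: CONTINUUM-LIMIT §27 (rh-explicit A6-PIVOT); M. Suzuki, J. Lond. Math. Soc. (2) 108 (2023) 1448–1487
[Suzuki2023] for the screw matrices this serves.
-/

noncomputable section

set_option linter.dupNamespace false -- D-0017: `Summit.<S>.<S>.…` is the designed namespace

namespace Summit.RiemannHypothesis.RiemannHypothesis.Theorems.IntegerScrew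

open Finset Real
open ArithmeticFunction (vonMangoldt)

/-- `H_R ≤ 1 + log R` in the `Icc` indexing (`R ≥ 1`). -/
theorem harmonic_Icc_le_one_add_log {R : ℕ} (hR : 1 ≤ R) : ∑ x ∈ Icc 1 R, 1 / (x : ℝ) ≤ 1 + Real.log R := by
  have h := harmonic_le_one_add_log R
  rw [harmonic_eq_sum_Icc] at h
  push_cast at h
  have hR' : R ≠ 0 := by omega
  simpa [one_div] using h

/-- `log(Q+1) ≤ H_Q` in the `Icc` indexing. -/
theorem log_succ_le_harmonic_Icc (Q : ℕ) : Real.log ((Q : ℝ) + 1) ≤ ∑ b ∈ Icc 1 Q, 1 / (b : ℝ) := by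
  have h := log_add_one_le_harmonic Q
  rw [harmonic_eq_sum_Icc] at h
  push_cast at h
  simpa [one_div] using h

/-- The energy profile `G(N) = log N + log 4 + e⁵ log(N+1)(log log N + 4)` is nondecreasing on `N ≥ 2`. -/
theorem energyProfile_mono {Y R : ℕ} (hY : 2 ≤ Y) (hYR : Y ≤ R) :
    Real.log Y + Real.log 4 + Real.exp 5 * Real.log ((Y : ℝ) + 1) * (Real.log (Real.log Y) + 4) ≤
      Real.log R + Real.log 4 + Real.exp 5 * Real.log ((R : ℝ) + 1) * (Real.log (Real.log R) + 4) := by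
  have hY2 : (2 : ℝ) ≤ Y := by exact_mod_cast hY
  have hYR' : (Y : ℝ) ≤ R := by exact_mod_cast hYR
  have hlY : 0 < Real.log Y := Real.log_pos (by linarith)
  have h1 : Real.log Y ≤ Real.log R := Real.log_le_log (by linarith) hYR'
  have h2 : Real.log ((Y : ℝ) + 1) ≤ Real.log ((R : ℝ) + 1) := Real.log_le_log (by linarith) (by linarith)
  have h3 : Real.log (Real.log Y) ≤ Real.log (Real.log R) := Real.log_le_log hlY h1
  have h4 : 0 ≤ Real.log (Real.log Y) + 4 := loglog_add_four_nonneg hY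
  have h5 : 0 ≤ Real.log ((R : ℝ) + 1) := Real.log_nonneg (by linarith)
  have h6 : 0 ≤ Real.log ((Y : ℝ) + 1) := Real.log_nonneg (by linarith)
  have : Real.log ((Y : ℝ) + 1) * (Real.log (Real.log Y) + 4) ≤ Real.log ((R : ℝ) + 1) * (Real.log (Real.log R) + 4) :=
    mul_le_mul h2 (by linarith) h4 h5
  nlinarith [Real.exp_pos 5]

/-- `(1 + e⁵)² ≤ (9/8)·e¹⁰`. -/
theorem one_add_exp_five_sq_le : (1 + Real.exp 5) ^ 2 ≤ 9 / 8 * Real.exp 10 := by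
  have e10 : Real.exp 10 = Real.exp 5 * Real.exp 5 := by rw [← Real.exp_add]; norm_num
  have h := Literature.NumberTheory.LFunctions.SiegelZero.HarmFlat.hundred_le_exp_five
  rw [e10]; nlinarith [Real.exp_pos 5]

/-- The coefficient arithmetic of the packaging: with `0 ≤ S ≤ 1 + L`, `ℓ ≤ H`, `1 ≤ P ≤ e⁵ℓ`, `(L − ℓ)/2 ≤ M`,
`100ℓ ≤ L − ℓ`, `1/2 < ℓ`: `S·P ≤ 8e⁵·(H·M)` (no sign condition on `S` is needed). -/
theorem thin_bottom_coef_le {S L ℓ H P M : ℝ} (hS : S ≤ 1 + L) (hH : ℓ ≤ H) (hP1 : 1 ≤ P)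
    (hP : P ≤ Real.exp 5 * ℓ) (hM : (L - ℓ) / 2 ≤ M) (hLℓ : 100 * ℓ ≤ L - ℓ) (hℓ : 1 / 2 < ℓ) :
    S * P ≤ 8 * Real.exp 5 * (H * M) := by
  have he := Literature.NumberTheory.LFunctions.SiegelZero.HarmFlat.hundred_le_exp_five
  have hM0 : 0 ≤ (L - ℓ) / 2 := by linarith
  have h1 : S * P ≤ (1 + L) * (Real.exp 5 * ℓ) := mul_le_mul hS hP (by linarith) (by linarith)
  have h2 : ℓ * ((L - ℓ) / 2) ≤ H * M := mul_le_mul hH hM hM0 (by linarith)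
  have h3 : 1 + L ≤ 4 * (L - ℓ) := by linarith
  have h4 : (1 + L) * (Real.exp 5 * ℓ) ≤ 4 * (L - ℓ) * (Real.exp 5 * ℓ) :=
    mul_le_mul_of_nonneg_right h3 (by positivity)
  have h5 : 4 * (L - ℓ) * (Real.exp 5 * ℓ) = 8 * Real.exp 5 * (ℓ * ((L - ℓ) / 2)) := by ring
  have h6 : 8 * Real.exp 5 * (ℓ * ((L - ℓ) / 2)) ≤ 8 * Real.exp 5 * (H * M) :=
    mul_le_mul_of_nonneg_left h2 (by positivity)
  linarith

/-- The final arithmetic: `E ≥ 0`, `A ≤ 9E`, `0 ≤ c² ≤ 64e¹⁰` give `3(E + c²(A + E)) ≤ 2000·e¹⁰·E`. -/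
theorem thin_bottom_total_le {E A c : ℝ} (hE : 0 ≤ E) (hA : A ≤ 9 * E) (hc : c ^ 2 ≤ 64 * Real.exp 10) :
    3 * (E + c ^ 2 * (A + E)) ≤ 2000 * Real.exp 10 * E := by
  have h10 : (1 : ℝ) ≤ Real.exp 10 := Real.one_le_exp (by norm_num)
  have hc0 : 0 ≤ c ^ 2 := sq_nonneg c
  by_cases hAE : 0 ≤ A + E
  · have h1 : c ^ 2 * (A + E) ≤ 64 * Real.exp 10 * (10 * E) :=
      mul_le_mul hc (by linarith) hAE (by positivity)
    nlinarith
  · have h1 : c ^ 2 * (A + E) ≤ 0 := mul_nonpos_of_nonneg_of_nonpos hc0 (le_of_lt (not_le.1 hAE))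
    nlinarith

/-- The `E_α`-versus-`E_K` arithmetic: `1 ≤ l₁`, `H ≤ 1 + l₁`, `0 ≤ G_Y ≤ G` give
`H·(4(1+e⁵)²/l₁²·G_Y) ≤ 9·(e¹⁰·G)`. -/
theorem thin_bottom_Ealpha_le {H l1 GY G : ℝ} (hl1 : 1 ≤ l1) (hH : H ≤ 1 + l1) (hGY : GY ≤ G) (hGY0 : 0 ≤ GY) :
    H * (4 * (1 + Real.exp 5) ^ 2 / l1 ^ 2 * GY) ≤ 9 * (Real.exp 10 * G) := by
  have hl0 : 0 < l1 := by linarith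
  have hH2 : H ≤ 2 * l1 ^ 2 := by nlinarith
  have hK0 : 0 ≤ 4 * (1 + Real.exp 5) ^ 2 := by positivity
  have hfrac : H * (4 * (1 + Real.exp 5) ^ 2 / l1 ^ 2) ≤ 8 * (1 + Real.exp 5) ^ 2 := by
    rw [← mul_div_assoc, div_le_iff₀ (by positivity)]
    have := mul_le_mul_of_nonneg_right hH2 hK0
    linarith
  have hexp := one_add_exp_five_sq_le
  have hG0 : 0 ≤ G := hGY0.trans hGY
  calc H * (4 * (1 + Real.exp 5) ^ 2 / l1 ^ 2 * GY)
      = H * (4 * (1 + Real.exp 5) ^ 2 / l1 ^ 2) * GY := by ring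
    _ ≤ 8 * (1 + Real.exp 5) ^ 2 * G := mul_le_mul hfrac hGY hGY0 (by positivity)
    _ ≤ 9 * (Real.exp 10 * G) := by nlinarith

/-- **PROPOSITION K″, packaged (CONTINUUM-LIMIT §27.2)**: for `2 ≤ Q` with `2e⁵·log Q ≤ log R − log Q` and every `g`,
`(Σ_{Q<x≤R} g x/x − (S_W/H_Q)·Σ_{b≤Q} g b/b)² ≤ 2000·e²⁰·(log R + log 4 + e⁵·log(R+1)·(log log R + 4))·D_{Ω_R}(g)`. -/
theorem propKK_thin_bottom {Q R : ℕ} (hQ : 2 ≤ Q)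
    (hQR : 2 * Real.exp 5 * Real.log Q ≤ Real.log R - Real.log Q) (g : ℕ → ℝ) :
    (∑ x ∈ Ioc Q R, g x / x -
        (∑ x ∈ Ioc Q R, 1 / (x : ℝ)) / (∑ b ∈ Icc 1 Q, 1 / (b : ℝ)) * ∑ b ∈ Icc 1 Q, g b / b) ^ 2 ≤
      2000 * Real.exp 20 *
          (Real.log R + Real.log 4 + Real.exp 5 * Real.log ((R : ℝ) + 1) * (Real.log (Real.log R) + 4)) *
        ∑ x ∈ Icc 1 R, (1 / (x : ℝ)) * ∑ n ∈ x.divisors, (vonMangoldt n : ℝ) * (g x - g (x / n)) ^ 2 := by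
  have he5 := Literature.NumberTheory.LFunctions.SiegelZero.HarmFlat.hundred_le_exp_five
  have hQ2 : (2 : ℝ) ≤ Q := by exact_mod_cast hQ
  have hℓ0 : (1 : ℝ) / 2 < Real.log Q := by
    have := Real.log_le_log (by norm_num) hQ2; linarith [Real.log_two_gt_d9]
  have hLℓ : 100 * Real.log Q ≤ Real.log R - Real.log Q := by nlinarith
  have hLpos : 0 < Real.log R := by linarith
  have hR1 : (1 : ℝ) < R := by
    by_contra h
    have := Real.log_nonpos (by positivity) (not_lt.1 h)
    linarith
  have hR0 : 0 < R := by exact_mod_cast (show (0 : ℝ) < R by linarith)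
  have hQpos : 0 < Q := by omega
  -- R ≥ Q², the hub range Y = R/Q
  have hRQ2 : Q * Q ≤ R := by
    have : Real.log ((Q : ℝ) * Q) ≤ Real.log R := by
      rw [Real.log_mul (by positivity) (by positivity)]; linarith
    have := (Real.log_le_log_iff (by positivity) (by positivity)).1 this
    exact_mod_cast this
  have hQY : Q ≤ R / Q := (Nat.le_div_iff_mul_le hQpos).2 hRQ2
  have hY2 : 2 ≤ R / Q := le_trans hQ hQY
  have hQYR : Q * (R / Q) ≤ R := Nat.mul_div_le R Q
  have hYR : R / Q ≤ R := Nat.div_le_self R Q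
  have hR2 : 2 ≤ R := le_trans hY2 hYR
  -- log(Y+1) ≥ L − ℓ
  have hY1 : Real.log R - Real.log Q ≤ Real.log (((R / Q : ℕ) : ℝ) + 1) := by
    have hlt : (R : ℝ) < Q * (((R / Q : ℕ) : ℝ) + 1) := by exact_mod_cast Nat.lt_mul_div_succ R hQpos
    have hdiv : (R : ℝ) / Q ≤ ((R / Q : ℕ) : ℝ) + 1 := by rw [div_le_iff₀ (by positivity)]; linarith
    have := Real.log_le_log (by positivity) hdiv
    rwa [Real.log_div (by positivity) (by positivity)] at this
  -- π_Q ≤ e⁵ ℓ < log(Y+1)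
  have hPrle : ∏ p ∈ (Q + 1).primesBelow, (1 - (1 : ℝ) / p)⁻¹ ≤ Real.exp 5 * Real.log Q :=
    prod_primesBelow_succ_inv_le hQ
  have hPr1 : 1 ≤ ∏ p ∈ (Q + 1).primesBelow, (1 - (1 : ℝ) / p)⁻¹ := by
    rw [← Finset.prod_const_one (s := (Q + 1).primesBelow)]
    refine Finset.prod_le_prod (fun _ _ => zero_le_one) fun p hp => ?_
    have hp2 : (2 : ℝ) ≤ p := by exact_mod_cast (Nat.mem_primesBelow.1 hp).2.two_le
    have h1 : 0 < 1 - (1 : ℝ) / p := by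
      have : (1 : ℝ) / p ≤ 1 / 2 := by rw [div_le_div_iff₀ (by linarith) (by norm_num)]; linarith
      linarith
    have h2 : 1 - (1 : ℝ) / p ≤ 1 := by
      have : 0 ≤ (1 : ℝ) / p := by positivity
      linarith
    simpa using (one_le_inv₀ h1).2 h2
  have hgap : (Real.log R - Real.log Q) / 2 ≤
      Real.log (((R / Q : ℕ) : ℝ) + 1) - ∏ p ∈ (Q + 1).primesBelow, (1 - (1 : ℝ) / p)⁻¹ := by
    nlinarith
  have hπ : ∏ p ∈ (Q + 1).primesBelow, (1 - (1 : ℝ) / p)⁻¹ < Real.log (((R / Q : ℕ) : ℝ) + 1) := by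
    nlinarith
  -- the explicit K″
  have h := propKK_explicit (le_trans (by norm_num) hQ) hY2 hQY hQYR hπ g
  -- harmonic sums
  have hSW0 : 0 ≤ ∑ x ∈ Ioc Q R, 1 / (x : ℝ) := Finset.sum_nonneg fun x _ => by positivity
  have hSWle : ∑ x ∈ Ioc Q R, 1 / (x : ℝ) ≤ 1 + Real.log R := by
    refine le_trans (Finset.sum_le_sum_of_subset_of_nonneg (fun x hx => ?_) fun x _ _ => by positivity)
      (harmonic_Icc_le_one_add_log (R := R) (by omega))
    have := Finset.mem_Ioc.1 hx; exact Finset.mem_Icc.2 ⟨by omega, this.2⟩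
  have hHQge' : Real.log ((Q : ℝ) + 1) ≤ ∑ b ∈ Icc 1 Q, 1 / (b : ℝ) := log_succ_le_harmonic_Icc Q
  have hℓl1 : Real.log Q ≤ Real.log ((Q : ℝ) + 1) := Real.log_le_log (by positivity) (by linarith)
  have hHQge : Real.log Q ≤ ∑ b ∈ Icc 1 Q, 1 / (b : ℝ) := hℓl1.trans hHQge'
  have hHQle : ∑ b ∈ Icc 1 Q, 1 / (b : ℝ) ≤ 1 + Real.log Q := harmonic_Icc_le_one_add_log (R := Q) (by omega)
  have hℓ'1 : 1 ≤ Real.log ((Q : ℝ) + 1) := by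
    have h3 : (3 : ℝ) ≤ (Q : ℝ) + 1 := by linarith
    have h3' : (1 : ℝ) ≤ Real.log 3 := by
      rw [← Real.log_exp 1]
      exact Real.log_le_log (Real.exp_pos 1) (by have := Real.exp_one_lt_d9; linarith)
    linarith [Real.log_le_log (by norm_num) h3]
  -- (i) the coefficient ≤ 8e⁵
  have hden : 0 < (∑ b ∈ Icc 1 Q, 1 / (b : ℝ)) *
      (Real.log (((R / Q : ℕ) : ℝ) + 1) - ∏ p ∈ (Q + 1).primesBelow, (1 - (1 : ℝ) / p)⁻¹) := by
    have : 0 < Real.log (((R / Q : ℕ) : ℝ) + 1) - ∏ p ∈ (Q + 1).primesBelow, (1 - (1 : ℝ) / p)⁻¹ := by linarith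
    have : 0 < ∑ b ∈ Icc 1 Q, 1 / (b : ℝ) := by linarith
    positivity
  have hcle : (∑ x ∈ Ioc Q R, 1 / (x : ℝ)) * (∏ p ∈ (Q + 1).primesBelow, (1 - (1 : ℝ) / p)⁻¹) /
      ((∑ b ∈ Icc 1 Q, 1 / (b : ℝ)) *
        (Real.log (((R / Q : ℕ) : ℝ) + 1) - ∏ p ∈ (Q + 1).primesBelow, (1 - (1 : ℝ) / p)⁻¹)) ≤ 8 * Real.exp 5 := by
    rw [div_le_iff₀ hden]
    exact thin_bottom_coef_le hSWle hHQge hPr1 hPrle hgap hLℓ hℓ0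
  have hc0 : 0 ≤ (∑ x ∈ Ioc Q R, 1 / (x : ℝ)) * (∏ p ∈ (Q + 1).primesBelow, (1 - (1 : ℝ) / p)⁻¹) /
      ((∑ b ∈ Icc 1 Q, 1 / (b : ℝ)) *
        (Real.log (((R / Q : ℕ) : ℝ) + 1) - ∏ p ∈ (Q + 1).primesBelow, (1 - (1 : ℝ) / p)⁻¹)) := by
    have : 0 ≤ (∑ x ∈ Ioc Q R, 1 / (x : ℝ)) * (∏ p ∈ (Q + 1).primesBelow, (1 - (1 : ℝ) / p)⁻¹) := by
      have : 0 ≤ ∏ p ∈ (Q + 1).primesBelow, (1 - (1 : ℝ) / p)⁻¹ := by linarith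
      positivity
    exact div_nonneg this hden.le
  have hc2 : ((∑ x ∈ Ioc Q R, 1 / (x : ℝ)) * (∏ p ∈ (Q + 1).primesBelow, (1 - (1 : ℝ) / p)⁻¹) /
      ((∑ b ∈ Icc 1 Q, 1 / (b : ℝ)) *
        (Real.log (((R / Q : ℕ) : ℝ) + 1) - ∏ p ∈ (Q + 1).primesBelow, (1 - (1 : ℝ) / p)⁻¹))) ^ 2 ≤
      64 * Real.exp 10 := by
    have e10 : Real.exp 10 = Real.exp 5 * Real.exp 5 := by rw [← Real.exp_add]; norm_num
    have := pow_le_pow_left₀ hc0 hcle 2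
    rw [e10]; nlinarith
  -- (ii) H_Q·E_α(Q,Y) ≤ 9·E_K(R)
  set G := Real.log R + Real.log 4 + Real.exp 5 * Real.log ((R : ℝ) + 1) * (Real.log (Real.log R) + 4) with hG
  set GY := Real.log ((R / Q : ℕ) : ℝ) + Real.log 4 +
    Real.exp 5 * Real.log ((((R / Q : ℕ) : ℝ)) + 1) * (Real.log (Real.log ((R / Q : ℕ) : ℝ)) + 4) with hGY
  have hEK0 : 0 ≤ Real.exp 10 * G := EK_nonneg hR2
  have hGYle : GY ≤ G := energyProfile_mono hY2 hYR
  have hGY0 : 0 ≤ GY := (mul_nonneg_iff_of_pos_left (Real.exp_pos 10)).1 (EK_nonneg hY2)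
  have hA : (∑ b ∈ Icc 1 Q, 1 / (b : ℝ)) * (4 * (1 + Real.exp 5) ^ 2 / Real.log ((Q : ℝ) + 1) ^ 2 * GY) ≤
      9 * (Real.exp 10 * G) :=
    thin_bottom_Ealpha_le hℓ'1 (by linarith) hGYle hGY0
  -- (iii) assemble
  have hD0 : 0 ≤ ∑ x ∈ Icc 1 R, (1 / (x : ℝ)) * ∑ n ∈ x.divisors, (vonMangoldt n : ℝ) * (g x - g (x / n)) ^ 2 :=
    Finset.sum_nonneg fun x _ => mul_nonneg (by positivity)
      (Finset.sum_nonneg fun n _ => mul_nonneg ArithmeticFunction.vonMangoldt_nonneg (sq_nonneg _))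
  refine h.trans (mul_le_mul_of_nonneg_right ?_ hD0)
  have htot := thin_bottom_total_le hEK0 hA hc2
  have e20 : Real.exp 20 = Real.exp 10 * Real.exp 10 := by rw [← Real.exp_add]; norm_num
  calc _ ≤ 2000 * Real.exp 10 * (Real.exp 10 * G) := htot
    _ = 2000 * Real.exp 20 * G := by rw [e20]; ring

end Summit.RiemannHypothesis.RiemannHypothesis.Theorems.IntegerScrew

end
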